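import Literature.InformationTheory.QuantumCodes.TwoBlockUnitFactor
import HarnessLib

/-!
# Wang–Pryadko 2022, Statement 1: the distance of a generalized-bicycle code equals the distance of its
# auxiliary asymmetric-bicycle (AB) code, `d = d' = min(d_X', d_Z')` — PROVED for every abelian two-block code

Source followed: R. Wang, L. P. Pryadko, *Distance bounds for generalized bicycle codes*, Symmetry **14**
(2022) 1348 = arXiv:2203.17216 [WangPryadko2022]; held text `paper:arxiv-2203.17216` (arXiv TeX, chunks
pNNNN), §3.1 (chunk p0006 L53–98) and the proof §6.2 (chunk p0013 L48–111), read on the page: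

> "The calculation of the distance is simplified somewhat with the help of an auxiliary asymmetric bicycle
> (AB) code `Q' ≡ css(H_X', H_Z)` where `H_X' = (A₁ | B₁)`, `A₁ ≡ a₁(P)`, `B₁ ≡ b₁(P)`, where
> `a₁(x) ≡ a(x)/gcd(a,b)`, `b₁(x) ≡ b(x)/gcd(a,b)` are obtained by dividing the two polynomials by the
> common factor, and the matrix `H_Z` is the same as in the original GB code … The AB code encodes half as
> many qudits as the original GB code, `k' = deg h(x)`. …
> **Statement 1.** The distance of the code `GB(a,b)` is the same as that of the associated AB code
> `css(H_X', H_Z)`, `d = d' = min(d_X', d_Z')`." (p0006 L58–94)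

## What is proved (binary abelian two-block codes `AbelianTwoBlock.css a b` of the tree; GB = `G = ℤ_ℓ`)

Write `f ⋆ a := circulant f *ᵥ a` for the product of the commutative group algebra `𝔽₂[G]`
(`circulant (f ⋆ a) = circulant f * circulant a`, Mathlib `circulant_mul`; as in `TwoBlockUnitFactor.lean`).
For a COMMON FACTOR `χ` and cofactors `a₁, b₁` put `a = χ ⋆ a₁`, `b = χ ⋆ b₁`.

* `AbelianTwoBlock.abCode χ a₁ b₁` — the auxiliary AB code `css(H_X' = [A₁ | B₁], H_Z = H_Z(a,b))`, a
  `CSSCode` of the tree; its commutation `H_X' H_Zᵀ = 0` is PROVED (`HX_mul_HZ_conv_transpose`).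
* `AbelianTwoBlock.kerX_abCode_le` / `rowSpX_css_le_rowSpX_abCode` — `ker H_X' ≤ ker H_X` and
  `rs H_X ≤ rs H_X'` (the AB code has fewer `Z`-logicals and more `X`-stabilizers; same `Z`-stabilizers).
* the dichotomy of §6.2 made precise (`abZLogical_or_abXLogical_of_zLogical`): a non-trivial `Z`-logical
  `u` of `css a b` is EITHER a non-trivial `Z`-logical of the AB code (when `H_X' u = 0`) OR — transported
  by the weight-preserving `X ↔ Z` permutation `colSwap` of `AbelianTwoBlockCodes.lean` — a non-trivial
  `X`-logical of the AB code (when `H_X' u ≠ 0`); conversely every non-trivial AB logical of either type is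
  a non-trivial logical of `css a b` of the same type (`css_dZ_le_of_abZLogical`, `css_dX_le_of_abXLogical`).
* **`AbelianTwoBlock.WangPryadko2022_statement1`**: `d_Z(css a b) = min(d_X', d_Z')`, and since
  `d_X = d_Z` for abelian two-block codes (`css_dX_eq_dZ`), `min(d_X, d_Z) = min(d_X', d_Z')`
  (`WangPryadko2022_statement1_min`); `ℕ∞` form `cssMinDist_css_eq_cssMinDist_abCode` (the Tillich–Zémor
  distances agree, including the `⊤` case `k = 0 ⟺ k' = 0`, `abCode_k_eq_zero_iff`).
* the printed dimension clause "`k' = deg h = k/2`" in certificate form: a Bézout pair `r, s` with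
  `a₁ ⋆ r + b₁ ⋆ s = δ₀` (which is what "dividing by `gcd(a,b)`" provides in `𝔽_q[x]`, and a fortiori in
  `𝔽_q[x]/(x^ℓ − 1)`) gives `rank H_X' = |G|` and **`2k' = k`** (`rank_HX_eq_card_of_bezout`,
  `two_mul_abCode_k_eq_of_bezout`); census form `WangPryadko2022_statement1_isCode`
  (`abCode` is `[[2ℓ, k', d]]` ⟹ `css a b` is `[[2ℓ, 2k', d]]`).

SCOPE / DEVIATIONS (declared). (i) The theorem holds for EVERY common factor `χ` (not only
`χ = gcd(a,b)`) and for every finite abelian `G`: the proof uses only `ker H_X' ≤ ker H_X`, `rs H_X ≤ rs H_X'`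
and the `X ↔ Z` symmetry of abelian two-block codes; coprimality of `a₁, b₁` enters only the dimension
clause. (ii) The tree's `CSSCode` is binary, so the `q`-ary statement is typed for `q = 2`
(TODO(general form): `𝔽_q`, with `H_Z = (Bᵀ, −Aᵀ)`). (iii) Statement 2 of the same section (the upper bound
`d_Z' ≤ d_g`) is in the tree in its GB form (`GBDistanceUpperBound.lean`); it is NOT re-derived here for the
AB code. No named facts, no instances, no notation.

## References (locators read on the page)
* [WangPryadko2022] arXiv:2203.17216 §3.1 Statement 1 (chunk p0006 L58–94); §6.2 "Proof of Statement 1"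
  (chunk p0013 L48–111: general solution `(u,v) = ξ(b₁,−a₁) + g(i₁,i₂)`; "the distance is given by the
  minimum of the union of the two sets, or, equivalently, `d' ≡ min(d_X', d_Z')`").
* [BravyiEtAl2024] arXiv:2308.07915 §4 Lemma 1 (the `X ↔ Z` map `(α,β) ↦ (Cβ,Cα)`; tree
  `AbelianTwoBlockCodes.lean`).
-/

namespace Literature.InformationTheory.QuantumCodes

namespace AbelianTwoBlock

open Matrix

variable {G : Type*} [Fintype G] [AddCommGroup G]

/-! ### The auxiliary AB code -/

/-- `H_X' H_Zᵀ = 0` for `H_X' = [A₁ | B₁]` and `H_Z = H_Z(χ⋆a₁, χ⋆b₁)`: all `G`-circulants commute and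
`2 = 0`. [cite: WangPryadko2022, §3.1 before Statement 1 (arXiv:2203.17216 chunk p0006 L58–70: "the matrix H_Z is the same as in the original GB code")] -/
theorem HX_mul_HZ_conv_transpose (χ a₁ b₁ : G → ZMod 2) :
    HX a₁ b₁ * (HZ (circulant χ *ᵥ a₁) (circulant χ *ᵥ b₁))ᵀ = 0 := by
  rw [HZ_conv, transpose_mul, transpose_transpose, ← Matrix.mul_assoc,
    HX_mul_HZ_transpose_eq_zero (by decide), Matrix.zero_mul]

/-- The **auxiliary asymmetric bicycle (AB) code** `css(H_X', H_Z)` of the two-block code on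
`(a, b) = (χ ⋆ a₁, χ ⋆ b₁)`: `X`-checks `H_X' = [A₁ | B₁]` on the cofactors, `Z`-checks those of the
original code. (Printed for `G = ℤ_ℓ` and `χ = gcd(a,b)`; any common factor `χ` is allowed here.)
[cite: WangPryadko2022, §3.1 (arXiv:2203.17216 chunk p0006 L58–70)] -/
def abCode (χ a₁ b₁ : G → ZMod 2) : CSSCode G G (G ⊕ G) :=
  ⟨HX a₁ b₁, HZ (circulant χ *ᵥ a₁) (circulant χ *ᵥ b₁), HX_mul_HZ_conv_transpose χ a₁ b₁⟩

/-- `(abCode χ a₁ b₁).HX = [A₁ | B₁]`. [cite: WangPryadko2022, §3.1 (arXiv:2203.17216 chunk p0006 L58–70)] -/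
@[simp] theorem abCode_HX (χ a₁ b₁ : G → ZMod 2) : (abCode χ a₁ b₁).HX = HX a₁ b₁ := rfl

/-- `(abCode χ a₁ b₁).HZ = H_Z(χ⋆a₁, χ⋆b₁)`. [cite: WangPryadko2022, §3.1 (arXiv:2203.17216 chunk p0006 L58–70)] -/
@[simp] theorem abCode_HZ (χ a₁ b₁ : G → ZMod 2) :
    (abCode χ a₁ b₁).HZ = HZ (circulant χ *ᵥ a₁) (circulant χ *ᵥ b₁) := rfl

/-- `H_X(χ⋆a₁, χ⋆b₁) u = χ ⋆ (H_X' u)`: the original `X`-syndrome is the common factor times the AB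
`X`-syndrome. [cite: WangPryadko2022, §6.2 (arXiv:2203.17216 chunk p0013 L62–66: "The coefficients … can be divided term-by-term by gcd(a,b)")] -/
theorem HX_conv_mulVec (χ a₁ b₁ : G → ZMod 2) (u : G ⊕ G → ZMod 2) :
    HX (circulant χ *ᵥ a₁) (circulant χ *ᵥ b₁) *ᵥ u = circulant χ *ᵥ (HX a₁ b₁ *ᵥ u) := by
  rw [HX_conv, mulVec_mulVec]

/-- `ker H_X' ≤ ker H_X`: every `Z`-codeword of the AB code is a `Z`-codeword of `css a b`.
[cite: WangPryadko2022, §3.1 (arXiv:2203.17216 chunk p0006 L81–86: "Taken separately, these two conditions yield the sets of X- and Z-codewords of the AB code")] -/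
theorem kerX_abCode_le (χ a₁ b₁ : G → ZMod 2) :
    (abCode χ a₁ b₁).kerX ≤ (css (circulant χ *ᵥ a₁) (circulant χ *ᵥ b₁)).kerX := by
  intro u hu
  rw [CSSCode.mem_kerX_iff] at hu ⊢
  rw [css_HX, HX_conv_mulVec, ← abCode_HX χ, hu, mulVec_zero]

/-- `rs H_X ≤ rs H_X'`: every `X`-stabilizer of `css a b` is an `X`-stabilizer of the AB code.
[cite: WangPryadko2022, §3.1 (arXiv:2203.17216 chunk p0006 L58–70)] -/
theorem rowSpX_css_le_rowSpX_abCode (χ a₁ b₁ : G → ZMod 2) :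
    (css (circulant χ *ᵥ a₁) (circulant χ *ᵥ b₁)).rowSpX ≤ (abCode χ a₁ b₁).rowSpX := by
  intro v hv
  obtain ⟨c, rfl⟩ := (mem_rowSpace_iff _ v).1 hv
  refine (mem_rowSpace_iff _ _).2 ⟨c ᵥ* circulant χ, ?_⟩
  rw [abCode_HX, css_HX, HX_conv, vecMul_vecMul]

/-- The two codes have the same `Z`-stabilizers: `rs H_Z' = rs H_Z`. [cite: WangPryadko2022, §3.1 (arXiv:2203.17216 chunk p0006 L67–70: "the matrix H_Z is the same as in the original GB code")] -/
theorem rowSpZ_abCode (χ a₁ b₁ : G → ZMod 2) :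
    (abCode χ a₁ b₁).rowSpZ = (css (circulant χ *ᵥ a₁) (circulant χ *ᵥ b₁)).rowSpZ := rfl

/-! ### Every AB logical is a logical of the two-block code -/

/-- A non-trivial `Z`-logical of the AB code is a non-trivial `Z`-logical of `css a b` (same weight), so
`d_Z ≤ |v|`. [cite: WangPryadko2022, §6.2 (arXiv:2203.17216 chunk p0013 L86–96)] -/
theorem css_dZ_le_of_abZLogical (χ a₁ b₁ : G → ZMod 2) {v : G ⊕ G → ZMod 2}
    (hv : (abCode χ a₁ b₁).HX *ᵥ v = 0) (hv' : v ∉ (abCode χ a₁ b₁).rowSpZ) :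
    (css (circulant χ *ᵥ a₁) (circulant χ *ᵥ b₁)).dZ ≤ hammingNorm v :=
  (css _ _).dZ_le_hammingNorm (kerX_abCode_le χ a₁ b₁ hv) (by rwa [rowSpZ_abCode] at hv')

/-- A non-trivial `X`-logical of the AB code is a non-trivial `X`-logical of `css a b`, so `d_X ≤ |v|`.
[cite: WangPryadko2022, §6.2 (arXiv:2203.17216 chunk p0013 L98–104)] -/
theorem css_dX_le_of_abXLogical (χ a₁ b₁ : G → ZMod 2) {v : G ⊕ G → ZMod 2}
    (hv : (abCode χ a₁ b₁).HZ *ᵥ v = 0) (hv' : v ∉ (abCode χ a₁ b₁).rowSpX) :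
    (css (circulant χ *ᵥ a₁) (circulant χ *ᵥ b₁)).dX ≤ hammingNorm v :=
  (css _ _).dX_le_hammingNorm hv (fun h => hv' (rowSpX_css_le_rowSpX_abCode χ a₁ b₁ h))

/-! ### The dichotomy: a logical of `css a b` is an AB `Z`-logical or (transported) an AB `X`-logical -/

/-- If `H_X' u ≠ 0` then the `X ↔ Z` transport `u ∘ colSwap` is NOT an `X`-stabilizer of the AB code:
`u ∘ colSwap ∈ rs H_X(a₁,b₁) ⟺ u ∈ rs H_Z(a₁,b₁) ⟹ H_X(a₁,b₁) u = 0`.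
[cite: WangPryadko2022, §6.2 (arXiv:2203.17216 chunk p0013 L98–111: "for a non-trivial vector in the AB code we must ensure that it remains non-zero with any ξ(x)")] -/
theorem comp_colSwap_not_mem_rowSpX_abCode (χ a₁ b₁ : G → ZMod 2) {u : G ⊕ G → ZMod 2}
    (hu : HX a₁ b₁ *ᵥ u ≠ 0) : u ∘ colSwap G ∉ (abCode χ a₁ b₁).rowSpX := by
  intro h
  have h' : u ∈ (css a₁ b₁).rowSpZ := by
    have h1 := (mem_range_vecMulLinear_HX_iff a₁ b₁ (u ∘ colSwap G)).1 h
    have h2 : (u ∘ colSwap G) ∘ colSwap G = u := funext fun j => by simp [colSwap_colSwap]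
    rwa [h2] at h1
  exact hu ((css a₁ b₁).rowSpZ_le_kerX h')

/-- **The dichotomy.** A non-trivial `Z`-logical `u` of `css a b` (`a = χ⋆a₁`, `b = χ⋆b₁`) is either a
non-trivial `Z`-logical of the AB code, or its weight-preserving transport `u ∘ colSwap` is a non-trivial
`X`-logical of the AB code. [cite: WangPryadko2022, §6.2 (arXiv:2203.17216 chunk p0013 L86–111: "the distance … is given by the minimum of the union of the two sets")] -/
theorem abZLogical_or_abXLogical_of_zLogical (χ a₁ b₁ : G → ZMod 2) {u : G ⊕ G → ZMod 2}
    (hu : (css (circulant χ *ᵥ a₁) (circulant χ *ᵥ b₁)).HX *ᵥ u = 0)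
    (hu' : u ∉ (css (circulant χ *ᵥ a₁) (circulant χ *ᵥ b₁)).rowSpZ) :
    ((abCode χ a₁ b₁).HX *ᵥ u = 0 ∧ u ∉ (abCode χ a₁ b₁).rowSpZ) ∨
      ((abCode χ a₁ b₁).HZ *ᵥ (u ∘ colSwap G) = 0 ∧ u ∘ colSwap G ∉ (abCode χ a₁ b₁).rowSpX) := by
  by_cases h : HX a₁ b₁ *ᵥ u = 0
  · exact Or.inl ⟨h, by rwa [rowSpZ_abCode]⟩
  · refine Or.inr ⟨?_, comp_colSwap_not_mem_rowSpX_abCode χ a₁ b₁ h⟩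
    rw [abCode_HZ, ← HX_mulVec_eq_zero_iff]
    exact hu

/-- Consequence: `min(d_X', d_Z') ≤ |u|` for every non-trivial `Z`-logical `u` of `css a b`.
[cite: WangPryadko2022, Statement 1 (arXiv:2203.17216 chunk p0006 L91–94)] -/
theorem min_abCode_dX_dZ_le_of_zLogical (χ a₁ b₁ : G → ZMod 2) {u : G ⊕ G → ZMod 2}
    (hu : (css (circulant χ *ᵥ a₁) (circulant χ *ᵥ b₁)).HX *ᵥ u = 0)
    (hu' : u ∉ (css (circulant χ *ᵥ a₁) (circulant χ *ᵥ b₁)).rowSpZ) :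
    min (abCode χ a₁ b₁).dX (abCode χ a₁ b₁).dZ ≤ hammingNorm u := by
  rcases abZLogical_or_abXLogical_of_zLogical χ a₁ b₁ hu hu' with ⟨h1, h2⟩ | ⟨h1, h2⟩
  · exact (min_le_right _ _).trans ((abCode χ a₁ b₁).dZ_le_hammingNorm h1 h2)
  · exact (min_le_left _ _).trans
      (((abCode χ a₁ b₁).dX_le_hammingNorm h1 h2).trans_eq (hammingNorm_comp_colSwap u))

/-! ### Statement 1 -/

/-- **Wang–Pryadko 2022, Statement 1** (`Z`-sector form): `d_Z(css a b) = min(d_X', d_Z')` for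
`a = χ ⋆ a₁`, `b = χ ⋆ b₁` and the AB code `css([A₁|B₁], H_Z(a,b))` — for every finite abelian `G` and
every common factor `χ` (both sides are `0` exactly when the codes have no logical operator).
[cite: WangPryadko2022, Statement 1 (arXiv:2203.17216 chunk p0006 L91–94: "The distance of the code GB(a,b) is the same as that of the associated AB code css(H_X',H_Z), d = d' = min(d_X',d_Z')")] -/
theorem WangPryadko2022_statement1 (χ a₁ b₁ : G → ZMod 2) :
    (css (circulant χ *ᵥ a₁) (circulant χ *ᵥ b₁)).dZ = min (abCode χ a₁ b₁).dX (abCode χ a₁ b₁).dZ := by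
  set C := css (circulant χ *ᵥ a₁) (circulant χ *ᵥ b₁) with hC
  set C' := abCode χ a₁ b₁ with hC'
  rcases Nat.eq_zero_or_pos C.dZ with h0 | hpos
  · -- no `Z`-logical in `css a b` ⟹ no `Z`-logical in the AB code ⟹ `d_Z' = 0`
    have hZ' : C'.dZ = 0 := by
      by_contra hne
      obtain ⟨v, hv, hv'⟩ := (C'.dZ_pos_iff).1 (Nat.pos_of_ne_zero hne)
      have := (C.dZ_pos_iff).2 ⟨v, kerX_abCode_le χ a₁ b₁ hv, by rwa [rowSpZ_abCode] at hv'⟩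
      omega
    rw [h0, hZ']
    simp
  · obtain ⟨u, hu, hu', hud⟩ := C.exists_hammingNorm_eq_dZ ((C.dZ_pos_iff).1 hpos)
    refine le_antisymm ?_ (hud ▸ min_abCode_dX_dZ_le_of_zLogical χ a₁ b₁ hu hu')
    -- the AB code has a logical (from the dichotomy), hence both `d_X', d_Z' > 0` and are attained
    have hk' : 0 < C'.dX ∧ 0 < C'.dZ := by
      rcases abZLogical_or_abXLogical_of_zLogical χ a₁ b₁ hu hu' with ⟨h1, h2⟩ | ⟨h1, h2⟩
      · have hz : 0 < C'.dZ := (C'.dZ_pos_iff).2 ⟨u, h1, h2⟩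
        exact ⟨Nat.pos_of_ne_zero fun h => (ne_of_gt hz) ((C'.dX_eq_zero_iff_dZ_eq_zero).1 h), hz⟩
      · have hx : 0 < C'.dX := (C'.dX_pos_iff).2 ⟨_, h1, h2⟩
        exact ⟨hx, Nat.pos_of_ne_zero fun h => (ne_of_gt hx) ((C'.dX_eq_zero_iff_dZ_eq_zero).2 h)⟩
    refine le_min ?_ ?_
    · obtain ⟨v, hv, hv', hvd⟩ := C'.exists_hammingNorm_eq_dX ((C'.dX_pos_iff).1 hk'.1)
      rw [← hvd, ← css_dX_eq_dZ]
      exact css_dX_le_of_abXLogical χ a₁ b₁ hv hv'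
    · obtain ⟨v, hv, hv', hvd⟩ := C'.exists_hammingNorm_eq_dZ ((C'.dZ_pos_iff).1 hk'.2)
      rw [← hvd]
      exact css_dZ_le_of_abZLogical χ a₁ b₁ hv hv'

/-- Statement 1, `X`-sector form (`d_X = d_Z` for abelian two-block codes).
[cite: WangPryadko2022, Statement 1 (arXiv:2203.17216 chunk p0006 L91–94)] -/
theorem WangPryadko2022_statement1_dX (χ a₁ b₁ : G → ZMod 2) :
    (css (circulant χ *ᵥ a₁) (circulant χ *ᵥ b₁)).dX = min (abCode χ a₁ b₁).dX (abCode χ a₁ b₁).dZ := by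
  rw [css_dX_eq_dZ, WangPryadko2022_statement1]

/-- **Statement 1 as printed: `d = d' = min(d_X', d_Z')`** with `d = min(d_X, d_Z)` of `css a b`.
[cite: WangPryadko2022, Statement 1 (arXiv:2203.17216 chunk p0006 L91–94)] -/
theorem WangPryadko2022_statement1_min (χ a₁ b₁ : G → ZMod 2) :
    min (css (circulant χ *ᵥ a₁) (circulant χ *ᵥ b₁)).dX (css (circulant χ *ᵥ a₁) (circulant χ *ᵥ b₁)).dZ =
      min (abCode χ a₁ b₁).dX (abCode χ a₁ b₁).dZ := by
  rw [WangPryadko2022_statement1_dX, WangPryadko2022_statement1, min_self]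

/-- `k' = 0 ⟺ k = 0`: the AB code is trivial exactly when `css a b` is.
[cite: WangPryadko2022, §3.1 (arXiv:2203.17216 chunk p0006 L70–72: "The AB code encodes half as many qudits as the original GB code")] -/
theorem abCode_k_eq_zero_iff (χ a₁ b₁ : G → ZMod 2) :
    (abCode χ a₁ b₁).k = 0 ↔ (css (circulant χ *ᵥ a₁) (circulant χ *ᵥ b₁)).k = 0 := by
  rw [CSSCode.k_eq_zero_iff_dX_eq_zero, CSSCode.k_eq_zero_iff_dX_eq_zero, WangPryadko2022_statement1_dX]
  constructor
  · intro h
    rw [h, Nat.zero_min]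
  · intro h
    rcases Nat.eq_zero_or_pos (abCode χ a₁ b₁).dX with h0 | hpos
    · exact h0
    · exfalso
      have hz : 0 < (abCode χ a₁ b₁).dZ :=
        Nat.pos_of_ne_zero fun hz => (ne_of_gt hpos) (((abCode χ a₁ b₁).dX_eq_zero_iff_dZ_eq_zero).2 hz)
      have := lt_min hpos hz
      omega

/-- **`ℕ∞` form of Statement 1**: the Tillich–Zémor minimum distances of `css a b` and of its AB code
coincide (`= min(d_X', d_Z')` when `k > 0`, `= ⊤` when `k = k' = 0`).
[cite: WangPryadko2022, Statement 1 (arXiv:2203.17216 chunk p0006 L91–94)] -/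
theorem cssMinDist_css_eq_cssMinDist_abCode (χ a₁ b₁ : G → ZMod 2) :
    cssMinDist (HX (circulant χ *ᵥ a₁) (circulant χ *ᵥ b₁)) (HZ (circulant χ *ᵥ a₁) (circulant χ *ᵥ b₁)) =
      cssMinDist (abCode χ a₁ b₁).HX (abCode χ a₁ b₁).HZ := by
  set C := css (circulant χ *ᵥ a₁) (circulant χ *ᵥ b₁) with hC
  change cssMinDist C.HX C.HZ = _
  rcases Nat.eq_zero_or_pos C.k with h0 | hpos
  · rw [C.cssMinDist_eq_top h0, (abCode χ a₁ b₁).cssMinDist_eq_top ((abCode_k_eq_zero_iff χ a₁ b₁).2 h0)]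
  · have hpos' : 0 < (abCode χ a₁ b₁).k :=
      Nat.pos_of_ne_zero fun h => (ne_of_gt hpos) ((abCode_k_eq_zero_iff χ a₁ b₁).1 h)
    rw [C.cssMinDist_eq_min_dX_dZ hpos, (abCode χ a₁ b₁).cssMinDist_eq_min_dX_dZ hpos',
      WangPryadko2022_statement1_min]

/-! ### The dimension clause `k' = k/2`: full-rank `H_X'` (Bézout certificate / coprime cofactors) -/

/-- `[A₁ | B₁] · [R ; S] = circulant(a₁ ⋆ r + b₁ ⋆ s)`. [cite: WangPryadko2022, §3.1 (arXiv:2203.17216 chunk p0006 L77–80: "Bézout coefficients such that a₁(x) r₁(x) + b₁(x) s₁(x) = 1")] -/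
theorem HX_mul_fromRows_circulant (a₁ b₁ r s : G → ZMod 2) :
    HX a₁ b₁ * fromRows (circulant r) (circulant s) =
      circulant (circulant a₁ *ᵥ r + circulant b₁ *ᵥ s) := by
  rw [HX_def, fromCols_mul_fromRows, circulant_mul, circulant_mul, circulant_add]

variable [DecidableEq G]

/-- A right inverse gives full rank: `H_X' · M = 1 ⟹ rank H_X' = |G|` (the step behind "`rank H_X' = ℓ`").
[cite: WangPryadko2022, §6.1 end (arXiv:2203.17216 chunk p0013 L43–45: "In the case of AB codes … rank H_X' = ℓ")] -/
theorem rank_HX_eq_card_of_mul_eq_one {a₁ b₁ : G → ZMod 2} {M : Matrix (G ⊕ G) G (ZMod 2)}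
    (h : HX a₁ b₁ * M = 1) : (HX a₁ b₁).rank = Fintype.card G := by
  refine le_antisymm (rank_le_card_height _) ?_
  have h2 := rank_mul_le_left (HX a₁ b₁) M
  rw [h, rank_one] at h2
  exact h2

/-- **A Bézout certificate gives full rank**: if `a₁ ⋆ r + b₁ ⋆ s = δ₀` then `rank [A₁ | B₁] = |G|`
("`rank H_X' = ℓ`"). [cite: WangPryadko2022, §6.1 end (arXiv:2203.17216 chunk p0013 L43–45: "In the case of AB codes … rank H_X' = ℓ, thus k' = deg h(x)")] -/
theorem rank_HX_eq_card_of_bezout {a₁ b₁ r s : G → ZMod 2}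
    (h : circulant a₁ *ᵥ r + circulant b₁ *ᵥ s = Pi.single 0 1) : (HX a₁ b₁).rank = Fintype.card G :=
  rank_HX_eq_card_of_mul_eq_one (M := fromRows (circulant r) (circulant s))
    (by rw [HX_mul_fromRows_circulant, h, circulant_single_one])

omit [DecidableEq G] in
/-- **`2k' = k`** whenever `rank H_X' = |G|` ("The AB code encodes half as many qudits as the original GB
code"): `k' = 2|G| − |G| − rank H_Z` and `k = 2|G| − 2 rank H_Z` (`rank H_X = rank H_Z`).
[cite: WangPryadko2022, §3.1 (arXiv:2203.17216 chunk p0006 L70–72) and §6.1 (chunk p0013 L43–45)] -/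
theorem two_mul_abCode_k_eq_of_rank (χ : G → ZMod 2) {a₁ b₁ : G → ZMod 2}
    (h : (HX a₁ b₁).rank = Fintype.card G) :
    2 * (abCode χ a₁ b₁).k = (css (circulant χ *ᵥ a₁) (circulant χ *ᵥ b₁)).k := by
  rw [CSSCode.k_eq, CSSCode.k_eq, abCode_HX, abCode_HZ, css_HX, css_HZ, h, rank_HZ, Fintype.card_sum]
  have h1 : (HX (circulant χ *ᵥ a₁) (circulant χ *ᵥ b₁)).rank ≤ Fintype.card G := rank_le_card_height _
  omega

/-- `2k' = k` from a Bézout certificate `a₁ ⋆ r + b₁ ⋆ s = δ₀` for the cofactors.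
[cite: WangPryadko2022, §3.1 (arXiv:2203.17216 chunk p0006 L70–80)] -/
theorem two_mul_abCode_k_eq_of_bezout (χ : G → ZMod 2) {a₁ b₁ r s : G → ZMod 2}
    (h : circulant a₁ *ᵥ r + circulant b₁ *ᵥ s = Pi.single 0 1) :
    2 * (abCode χ a₁ b₁).k = (css (circulant χ *ᵥ a₁) (circulant χ *ᵥ b₁)).k :=
  two_mul_abCode_k_eq_of_rank χ (rank_HX_eq_card_of_bezout h)

omit [DecidableEq G] in
/-- **Statement 1 as a census row.** If `rank H_X' = |G|` and the AB code is `[[n, k', d]]`, then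
`css a b` is `[[n, 2k', d]]` (`d = d'`, `k = 2k'`).
[cite: WangPryadko2022, Statement 1 and the sentence before it (arXiv:2203.17216 chunk p0006 L70–94)] -/
theorem WangPryadko2022_statement1_isCode_of_rank (χ : G → ZMod 2) {a₁ b₁ : G → ZMod 2}
    (h : (HX a₁ b₁).rank = Fintype.card G) {n k' d : ℕ} (hC' : (abCode χ a₁ b₁).IsCode n k' d) :
    (css (circulant χ *ᵥ a₁) (circulant χ *ᵥ b₁)).IsCode n (2 * k') d := by
  obtain ⟨hn, hk, hd⟩ := hC'
  refine ⟨hn, ?_, ?_⟩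
  · rw [← two_mul_abCode_k_eq_of_rank χ h, hk]
  · rw [css_HX, css_HZ, cssMinDist_css_eq_cssMinDist_abCode, hd]

/-- Census-row form with a Bézout certificate `a₁ ⋆ r + b₁ ⋆ s = δ₀` (decidable data for a concrete code).
[cite: WangPryadko2022, Statement 1 (arXiv:2203.17216 chunk p0006 L70–94)] -/
theorem WangPryadko2022_statement1_isCode (χ : G → ZMod 2) {a₁ b₁ r s : G → ZMod 2}
    (h : circulant a₁ *ᵥ r + circulant b₁ *ᵥ s = Pi.single 0 1) {n k' d : ℕ}
    (hC' : (abCode χ a₁ b₁).IsCode n k' d) :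
    (css (circulant χ *ᵥ a₁) (circulant χ *ᵥ b₁)).IsCode n (2 * k') d :=
  WangPryadko2022_statement1_isCode_of_rank χ (rank_HX_eq_card_of_bezout h) hC'

end AbelianTwoBlock

/-! ### The printed cyclic case: coprime cofactor POLYNOMIALS `gcd(a₁, b₁) = 1` in `𝔽₂[x]` -/

namespace AbelianTwoBlock

open Matrix Polynomial

variable {ℓ : ℕ} [NeZero ℓ]

/-- **"`a₁ ≡ a/gcd(a,b)`, `b₁ ≡ b/gcd(a,b)` … `gcd(a₁,b₁) = 1`" ⟹ `rank H_X' = ℓ`** for `ℤ_ℓ`-circulants: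
evaluate a Bézout identity `u a₁ + v b₁ = 1` of `𝔽₂[x]` at the cyclic shift `P` (`a₁(P) = circulant a₁`,
`aeval_circulant_single_vecPoly`); the right inverse `[u(P) ; v(P)]` of `[A₁ | B₁]` need not be reduced.
[cite: WangPryadko2022, §3.1 (arXiv:2203.17216 chunk p0006 L64–80) and §6.1 (chunk p0013 L43–45: "rank H_X' = ℓ, thus k' = deg h(x)")] -/
theorem rank_HX_eq_of_isCoprime (a₁ b₁ : Fin ℓ → ZMod 2) (h : IsCoprime (gbPoly a₁) (gbPoly b₁)) :
    (HX a₁ b₁).rank = ℓ := by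
  obtain ⟨u, v, huv⟩ := h
  have ha : aeval (circulant (Pi.single (1 : Fin ℓ) (1 : ZMod 2))) (gbPoly a₁) = circulant a₁ :=
    aeval_circulant_single_vecPoly a₁
  have hb : aeval (circulant (Pi.single (1 : Fin ℓ) (1 : ZMod 2))) (gbPoly b₁) = circulant b₁ :=
    aeval_circulant_single_vecPoly b₁
  have h1 : HX a₁ b₁ * fromRows (aeval (circulant (Pi.single (1 : Fin ℓ) (1 : ZMod 2))) u)
      (aeval (circulant (Pi.single (1 : Fin ℓ) (1 : ZMod 2))) v) = 1 := by
    rw [HX_def, fromCols_mul_fromRows, ← ha, ← hb, ← map_mul, ← map_mul, ← map_add,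
      mul_comm (gbPoly a₁), mul_comm (gbPoly b₁), huv, map_one]
  rw [rank_HX_eq_card_of_mul_eq_one h1, Fintype.card_fin]

/-- The literal `gcd(a₁, b₁) = 1` spelling (Euclidean `gcd` in `𝔽₂[x]`). [cite: WangPryadko2022, §3.1 (arXiv:2203.17216 chunk p0006 L64–80)] -/
theorem rank_HX_eq_of_gcd_eq_one (a₁ b₁ : Fin ℓ → ZMod 2)
    (h : EuclideanDomain.gcd (gbPoly a₁) (gbPoly b₁) = 1) : (HX a₁ b₁).rank = ℓ := by
  refine rank_HX_eq_of_isCoprime a₁ b₁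
    ⟨EuclideanDomain.gcdA (gbPoly a₁) (gbPoly b₁), EuclideanDomain.gcdB (gbPoly a₁) (gbPoly b₁), ?_⟩
  rw [mul_comm (EuclideanDomain.gcdA _ _), mul_comm (EuclideanDomain.gcdB _ _),
    ← EuclideanDomain.gcd_eq_gcd_ab, h]

/-- **"The AB code encodes half as many qudits as the original GB code"**, `2k' = k`, for `GB(χ a₁, χ b₁)`
over `ℤ_ℓ` with coprime cofactor polynomials `gcd(a₁, b₁) = 1` — the printed setting `χ = gcd(a,b)`.
[cite: WangPryadko2022, §3.1 (arXiv:2203.17216 chunk p0006 L64–72: "The AB code encodes half as many qudits as the original GB code, k' = deg h(x)")] -/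
theorem two_mul_abCode_k_eq_of_gcd_eq_one (χ a₁ b₁ : Fin ℓ → ZMod 2)
    (h : EuclideanDomain.gcd (gbPoly a₁) (gbPoly b₁) = 1) :
    2 * (abCode χ a₁ b₁).k = (css (circulant χ *ᵥ a₁) (circulant χ *ᵥ b₁)).k :=
  two_mul_abCode_k_eq_of_rank χ (by rw [rank_HX_eq_of_gcd_eq_one a₁ b₁ h, Fintype.card_fin])

/-- **Statement 1 for GB codes as printed, census form**: `a = χ a₁`, `b = χ b₁` with `gcd(a₁,b₁) = 1` in
`𝔽₂[x]` (e.g. `χ = gcd(a,b)`): the AB code `css([A₁|B₁], H_Z)` is `[[2ℓ, k', d]]` ⟹ `GB(a,b)` is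
`[[2ℓ, 2k', d]]`. [cite: WangPryadko2022, Statement 1 (arXiv:2203.17216 chunk p0006 L58–94)] -/
theorem WangPryadko2022_statement1_isCode_of_gcd_eq_one (χ a₁ b₁ : Fin ℓ → ZMod 2)
    (h : EuclideanDomain.gcd (gbPoly a₁) (gbPoly b₁) = 1) {n k' d : ℕ}
    (hC' : (abCode χ a₁ b₁).IsCode n k' d) :
    (css (circulant χ *ᵥ a₁) (circulant χ *ᵥ b₁)).IsCode n (2 * k') d :=
  WangPryadko2022_statement1_isCode_of_rank χ (by rw [rank_HX_eq_of_gcd_eq_one a₁ b₁ h, Fintype.card_fin]) hC'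

end AbelianTwoBlock

end Literature.InformationTheory.QuantumCodes
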